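import Mathlib
import Summits.FinalStateConjecture.FinalStateConjecture.Theorems.PhotonSphereChannelsParametricPrimitive
import Summits.FinalStateConjecture.FinalStateConjecture.Theorems.PhotonSphereChannelsUniformPhotonSphereChannelsRPeelCalculus

/-!
# Peeling, file 4: time primitives `∫₀ᵗ θ(τ, x) dτ` of functions on the half-plane `{x > a}`

Support file for `stub_peel` of the line `crum-peeling-recessive-tower` (crux
`UniformPhotonSphereChannelsR`, stmt-FinalStateConjecture-14074).  The energy-level Darboux rung
`θ ↦ θ̃` integrates `(∂ₓ − W)θ` in time; this file supplies the calculus of the time primitive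
`P(t, x) = ∫₀ᵗ θ(τ, x) dτ` of a function `θ` that is `Cⁿ` on the open half-plane only:

* `exists_halfPlane_extension_of_contDiffOn` — the `Cⁿ` cut-off extension (as in file 2 for
  `n = 2`);
* `contDiffOn_timePrimitive` — `P ∈ Cⁿ(H)` (locally `P` is the parametric primitive of a global
  `Cⁿ` function, `WaveEnergy.contDiff_parametric_primitive_nat`);
* `hasDerivAt_timePrimitive_fst` — `∂ₜ P = θ`;
* `hasDerivAt_timePrimitive_snd` — `∂ₓ P(t, ·) = ∫₀ᵗ ∂ₓθ(τ, ·) dτ` for `θ ∈ C¹(H)`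
  (`WaveEnergy.fderiv_parametric_primitive_of_contDiff_one`).
-/

noncomputable section

-- the doubled `FinalStateConjecture` component is the tree's fixed summit/problem path
set_option linter.dupNamespace false

namespace Summit.FinalStateConjecture.FinalStateConjecture.Theorems.CrumPeelingRecessiveTower

open MeasureTheory Set Filter Topology intervalIntegral
open Summit.FinalStateConjecture.FinalStateConjecture.Theorems.WaveEnergy

/-! ### `Cⁿ` cut-off extension -/

/-- **`Cⁿ` cut-off extension** from the half-plane `{x > a}`: a function `Cⁿ` on `{x > a}` agrees
on `{x > (a+b)/2}` (`b > a`) with a global `Cⁿ` function. -/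
theorem exists_halfPlane_extension_of_contDiffOn {θ : ℝ → ℝ → ℝ} {a b : ℝ} {n : ℕ} (hab : a < b)
    (hθ : ContDiffOn ℝ n (Function.uncurry θ) {z : ℝ × ℝ | a < z.2}) :
    ∃ Θ : ℝ × ℝ → ℝ, ContDiff ℝ n Θ ∧ ∀ z : ℝ × ℝ, (a + b) / 2 < z.2 → Θ z = θ z.1 z.2 := by
  -- a `Cⁿ` cut-off: `0` below `a + (b−a)/4`, `1` above `(a+b)/2`
  set χ : ℝ → ℝ := fun x => Real.smoothTransition ((x - a - (b - a) / 4) / ((b - a) / 4)) with hχ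
  have hχC : ContDiff ℝ n χ :=
    (Real.smoothTransition.contDiff (n := n)).comp
      (by fun_prop : ContDiff ℝ n (fun x : ℝ => (x - a - (b - a) / 4) / ((b - a) / 4)))
  have hχ0 : ∀ x, x ≤ a + (b - a) / 4 → χ x = 0 := fun x hx =>
    Real.smoothTransition.zero_of_nonpos (div_nonpos_of_nonpos_of_nonneg (by linarith) (by linarith))
  have hχ1 : ∀ x, (a + b) / 2 ≤ x → χ x = 1 := fun x hx => by
    apply Real.smoothTransition.one_of_one_le
    rw [le_div_iff₀ (by linarith)]
    linarith
  have hH : IsOpen {z : ℝ × ℝ | a < z.2} := isOpen_lt continuous_const continuous_snd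
  have hO : IsOpen {z : ℝ × ℝ | z.2 < a + (b - a) / 4} := isOpen_lt continuous_snd continuous_const
  refine ⟨fun z => χ z.2 * θ z.1 z.2, ?_, fun z hz => ?_⟩
  · rw [contDiff_iff_contDiffAt]
    intro z
    by_cases hz : a < z.2
    · exact ((hχC.comp contDiff_snd).contDiffAt).mul (hθ.contDiffAt (hH.mem_nhds hz))
    · have hz' : z.2 < a + (b - a) / 4 := by linarith [not_lt.1 hz, sub_pos.2 hab]
      have hev : (fun w : ℝ × ℝ => χ w.2 * θ w.1 w.2) =ᶠ[𝓝 z] fun _ => 0 := by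
        filter_upwards [hO.mem_nhds hz'] with w hw
        rw [hχ0 w.2 (le_of_lt hw), zero_mul]
      exact contDiffAt_const.congr_of_eventuallyEq hev
  · show χ z.2 * θ z.1 z.2 = θ z.1 z.2
    rw [hχ1 z.2 hz.le, one_mul]

/-- Local `Cⁿ` representation: near every abscissa `x₀ > a`, a function `Cⁿ` on the half-plane is
a global `Cⁿ` function on a whole smaller half-plane `{x > m}`, `a ≤ m < x₀`. -/
theorem exists_local_representation {θ : ℝ → ℝ → ℝ} {a : ℝ} {n : ℕ}
    (hθ : ContDiffOn ℝ n (Function.uncurry θ) {z : ℝ × ℝ | a < z.2}) {x₀ : ℝ} (hx₀ : a < x₀) :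
    ∃ (Θ : ℝ × ℝ → ℝ) (m : ℝ), ContDiff ℝ n Θ ∧ a ≤ m ∧ m < x₀ ∧
      ∀ τ y, m < y → θ τ y = Θ (τ, y) := by
  obtain ⟨Θ, hΘ, hagree⟩ := exists_halfPlane_extension_of_contDiffOn hx₀ hθ
  exact ⟨Θ, (a + x₀) / 2, hΘ, by linarith, by linarith, fun τ y hy => (hagree (τ, y) hy).symm⟩

/-! ### The time primitive -/

/-- **The time primitive is `Cⁿ` on the half-plane** when `θ` is. -/
theorem contDiffOn_timePrimitive {θ : ℝ → ℝ → ℝ} {a : ℝ} {n : ℕ}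
    (hθ : ContDiffOn ℝ n (Function.uncurry θ) {z : ℝ × ℝ | a < z.2}) :
    ContDiffOn ℝ n (Function.uncurry fun t x => ∫ τ in (0 : ℝ)..t, θ τ x) {z : ℝ × ℝ | a < z.2} := by
  intro z hz
  obtain ⟨Θ, m, hΘ, -, hmx, hrep⟩ := exists_local_representation hθ (x₀ := z.2) hz
  have hΨ : ContDiff ℝ n fun q : ℝ × ℝ => ∫ s in (0 : ℝ)..q.1, Θ (s, q.2) :=
    contDiff_parametric_primitive_nat n hΘ
  have hev : (Function.uncurry fun t x => ∫ τ in (0 : ℝ)..t, θ τ x)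
      =ᶠ[𝓝 z] fun q : ℝ × ℝ => ∫ s in (0 : ℝ)..q.1, Θ (s, q.2) := by
    filter_upwards [(isOpen_lt continuous_const continuous_snd).mem_nhds (show m < z.2 from hmx)]
      with q hq
    exact intervalIntegral.integral_congr fun s _ => hrep s q.2 hq
  exact (hΨ.contDiffAt.congr_of_eventuallyEq hev).contDiffWithinAt

/-- Slices `τ ↦ θ(τ, x)` (`x > a`) of a function continuous on the half-plane are continuous. -/
theorem continuous_slice_fst {θ : ℝ → ℝ → ℝ} {a : ℝ}
    (hθ : ContinuousOn (Function.uncurry θ) {z : ℝ × ℝ | a < z.2}) {x : ℝ} (hx : a < x) :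
    Continuous fun τ => θ τ x := by
  have h : Continuous fun τ : ℝ => (τ, x) := continuous_id.prodMk continuous_const
  exact hθ.comp_continuous h fun τ => hx

/-- Slices `y ↦ θ(t, y)` of a function continuous on the half-plane are continuous on `(a, ∞)`. -/
theorem continuousOn_slice_snd {θ : ℝ → ℝ → ℝ} {a : ℝ}
    (hθ : ContinuousOn (Function.uncurry θ) {z : ℝ × ℝ | a < z.2}) (t : ℝ) :
    ContinuousOn (θ t) (Ioi a) := by
  have h : Continuous fun y : ℝ => (t, y) := continuous_const.prodMk continuous_id
  exact hθ.comp h.continuousOn fun y hy => hy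

/-- **`∂ₜ` of the time primitive**: `∂ₜ ∫₀ᵗ θ(τ, x) dτ = θ(t, x)` for `x > a`. -/
theorem hasDerivAt_timePrimitive_fst {θ : ℝ → ℝ → ℝ} {a : ℝ}
    (hθ : ContinuousOn (Function.uncurry θ) {z : ℝ × ℝ | a < z.2}) (t : ℝ) {x : ℝ} (hx : a < x) :
    HasDerivAt (fun τ => ∫ s in (0 : ℝ)..τ, θ s x) (θ t x) t := by
  have hc := continuous_slice_fst hθ hx
  exact intervalIntegral.integral_hasDerivAt_right (hc.intervalIntegrable _ _)
    (hc.stronglyMeasurableAtFilter _ _) hc.continuousAt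

/-- **`∂ₓ` of the time primitive**: for `θ ∈ C¹` on the half-plane and `x > a`,
`∂ₓ ∫₀ᵗ θ(s, ·) ds = ∫₀ᵗ ∂ₓθ(s, x) ds` (differentiation under the integral on a compact time
interval, through the local global-`C¹` representation). -/
theorem hasDerivAt_timePrimitive_snd {θ : ℝ → ℝ → ℝ} {a : ℝ}
    (hθ : ContDiffOn ℝ 1 (Function.uncurry θ) {z : ℝ × ℝ | a < z.2}) (t : ℝ) {x : ℝ} (hx : a < x) :
    HasDerivAt (fun y => ∫ s in (0 : ℝ)..t, θ s y) (∫ s in (0 : ℝ)..t, deriv (θ s) x) x := by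
  obtain ⟨Θ, m, hΘ, -, hmx, hrep⟩ := exists_local_representation (n := 1) hθ hx
  set Ψ : ℝ × ℝ → ℝ := fun q => ∫ s in (0 : ℝ)..q.1, Θ (s, q.2) with hΨ
  have hΨC : ContDiff ℝ 1 Ψ := contDiff_parametric_primitive_nat (Q := ℝ) 1 (by exact_mod_cast hΘ)
  have hΨd : Differentiable ℝ Ψ := hΨC.differentiable (by norm_num)
  have hΘd : Differentiable ℝ Θ := hΘ.differentiable (by norm_num)
  -- the `x`-slice of `Ψ` and its derivative
  have h1 : HasDerivAt (fun y => Ψ (t, y)) (fderiv ℝ Ψ (t, x) (0, 1)) x := hasDerivAt_slice_snd hΨd t x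
  have h2 : fderiv ℝ Ψ (t, x) (0, 1) = ∫ s in (0 : ℝ)..t, fderiv ℝ Θ (s, x) ((0 : ℝ), (1 : ℝ)) := by
    have h := fderiv_parametric_primitive_of_contDiff_one (Q := ℝ) (by exact_mod_cast hΘ) t x 0 1
    simpa [hΨ] using h
  -- identify the integrand with `deriv (θ s) x`
  have h3 : ∀ s, fderiv ℝ Θ (s, x) ((0 : ℝ), (1 : ℝ)) = deriv (θ s) x := by
    intro s
    have hd : HasDerivAt (fun y => Θ (s, y)) (fderiv ℝ Θ (s, x) (0, 1)) x := hasDerivAt_slice_snd hΘd s x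
    have hev : (fun y => Θ (s, y)) =ᶠ[𝓝 x] θ s := by
      filter_upwards [Ioi_mem_nhds hmx] with y hy
      exact (hrep s y hy).symm
    exact ((hd.congr_of_eventuallyEq hev.symm).deriv).symm
  rw [h2, intervalIntegral.integral_congr fun s _ => h3 s] at h1
  refine h1.congr_of_eventuallyEq ?_
  filter_upwards [Ioi_mem_nhds hmx] with y hy
  exact intervalIntegral.integral_congr fun s _ => hrep s y hy

/-- Registered sub-goal `peel_timePrimitiveDeriv` of `stub_peel` (verbatim signature): differentiation of the time primitive under the integral sign on the half-plane. -/
theorem peel_timePrimitiveDeriv : ∀ (θ : ℝ → ℝ → ℝ) (a : ℝ), ContDiffOn ℝ 1 (Function.uncurry θ) {z : ℝ × ℝ | a < z.2} → ∀ (t x : ℝ), a < x → HasDerivAt (fun y => intervalIntegral (fun s => θ s y) 0 t MeasureTheory.volume) (intervalIntegral (fun s => deriv (θ s) x) 0 t MeasureTheory.volume) x :=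
  fun _ _ hθ t _ hx => hasDerivAt_timePrimitive_snd hθ t hx

end Summit.FinalStateConjecture.FinalStateConjecture.Theorems.CrumPeelingRecessiveTower
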